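import Mathlib
import Literature.Computability.AlgebraicComplexity.DeterminantalConormalBound
import Summits.ValiantsHypothesis.ValiantsHypothesis.Theorems.DetQPDetqpSuperquadraticStubPolarPersistence

/-!
# Crux `RefutationDegree.RefutationBarrier` (stmt-ValiantsHypothesis-5642), line `Sketch_ideator5` —
stub T2 `stub_polarPersistenceCoeff`: persistence of non-degenerate polar points under
coefficientwise perturbation of the polynomial

For a polynomial `g` in `N` variables and a pencil/chart datum `(a, b, c) ∈ (ℂ^N)³` the polar set
`T_g(a, b, c)` (`Literature.Computability.AlgebraicComplexity.polarSet`) consists of the points `x`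
with `g(x) = 0`, `∇g(x) ≠ 0`, `∇g(x) ∈ ℂa + ℂb`, `c · x = 1`; a polar point is *non-degenerate*
when the bordered-Hessian Jacobian `J(g, x) = [[∂ᵢ∂ⱼg(x), (aᵢ bᵢ)], [(∂ⱼg(x); cⱼ), 0]]` is
invertible.  This file proves the registered stub

* `stub_polarPersistenceCoeff` : if `T_g(a, b, c)` contains a finite set `F` of non-degenerate
  polar points and `G_j → g` coefficientwise with `deg G_j ≤ d`, then for all large `j` the polar
  set `T_{G_j}(a, b, c)` (SAME datum) contains at least `|F|` non-degenerate polar points.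

**Proof** (the argument of the tree's `stub_polarPersistenceND`,
`Theorems/DetQPDetqpSuperquadraticStubPolarPersistenceND.lean`, with the datum `u` replaced by the
coefficient vector as the parameter of the implicit function theorem).  All `G_j` — hence, passing
to the limit, `g` — are supported on the finite set `S` of exponents of degree `≤ d`, so they are
members `p_θ = Σ_{μ ∈ S} θ_μ x^μ` of ONE linear family indexed by `θ ∈ ℂ^S`, with `θ_j → θ_∞`.
A polar point `x₀` of `p_{θ₀}` with multipliers `(s, t)` gives a zero `(x₀, -s, -t)` of the square
system `((∂ᵢp_θ(x) + s'aᵢ + t'bᵢ)ᵢ, p_θ(x), Σ cⱼxⱼ)` in `z = (x, s', t')` with parameter `θ`; the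
system is polynomial in `(x, θ)` jointly (it is the evaluation of the fixed polynomial
`Pj = Σ_μ Θ_μ x^μ ∈ ℂ[x, Θ]` and of its `x`-derivatives), hence strictly differentiable
(`PolarPersistence.hasStrictFDerivAt_eval`), and its `z`-Jacobian at `(θ₀; x₀, -s, -t)` is the
bordered Hessian.  Mathlib's `HasStrictFDerivAt.implicitFunctionOfProdDomain` gives a branch
`θ ↦ x(θ) → x₀` of zeros, i.e. of polar points of `p_θ`; `∇p_θ(x) ≠ 0` and `det J ≠ 0` persist by
joint continuity (`PolarPersistenceCoeff.exists_branch`).  Finitely many branches with distinct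
limits stay pairwise distinct near `θ_∞`; pulling back along `j ↦ θ_j` gives the claim.
No new definitions; self-contained on Mathlib, the Literature entry `DeterminantalConormalBound`
(`polarSet`) and the tree file `…StubPolarPersistence` (`hasStrictFDerivAt_eval`,
`pderiv_pderiv_comm`).
-/

set_option linter.dupNamespace false

noncomputable section

namespace Summit.ValiantsHypothesis.ValiantsHypothesis.Theorems.RefutationDegree

open Filter Topology MvPolynomial
open Literature.Computability.AlgebraicComplexity (polarSet mem_polarSet)
open Summit.ValiantsHypothesis.ValiantsHypothesis.Theorems.DetQPDetqpSuperquadratic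

namespace PolarPersistenceCoeff

variable {N : ℕ} {ι : Type*} [Fintype ι]

/-- Partial derivatives of a linear family `p_θ = Σ_μ θ_μ q_μ`: `∂ᵢ p_θ = Σ_μ θ_μ ∂ᵢ q_μ`.
[folklore] -/
theorem pderiv_family (q : ι → MvPolynomial (Fin N) ℂ) (θ : ι → ℂ) (i : Fin N) :
    pderiv i (∑ μ, C (θ μ) * q μ) = ∑ μ, C (θ μ) * pderiv i (q μ) := by
  rw [map_sum]
  exact Finset.sum_congr rfl fun μ _ => pderiv_C_mul

/-- The joint polynomial `Pj = Σ_μ Θ_μ · q_μ(x) ∈ ℂ[x, Θ]` of a family `(q_μ)`: its `xᵢ`-derivative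
is the joint polynomial of the family `(∂ᵢ q_μ)`. [folklore] -/
theorem pderiv_inl_joint (q : ι → MvPolynomial (Fin N) ℂ) (i : Fin N) :
    pderiv (Sum.inl i)
        (∑ μ, X (Sum.inr μ) * rename Sum.inl (q μ) : MvPolynomial (Fin N ⊕ ι) ℂ) =
      ∑ μ, X (Sum.inr μ) * rename Sum.inl (pderiv i (q μ)) := by
  rw [map_sum]
  refine Finset.sum_congr rfl fun μ _ => ?_
  rw [pderiv_mul, pderiv_X_of_ne Sum.inr_ne_inl, zero_mul, zero_add,
    pderiv_rename Sum.inl_injective]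

/-- Evaluating the joint polynomial `Pj = Σ_μ Θ_μ · q_μ(x)` at `(x, θ)` evaluates the member
`p_θ = Σ_μ θ_μ q_μ` of the family at `x`. [folklore] -/
theorem eval_joint (q : ι → MvPolynomial (Fin N) ℂ) (x : Fin N → ℂ) (θ : ι → ℂ) :
    eval (Sum.elim x θ)
        (∑ μ, X (Sum.inr μ) * rename Sum.inl (q μ) : MvPolynomial (Fin N ⊕ ι) ℂ) =
      eval x (∑ μ, C (θ μ) * q μ) := by
  simp only [map_sum, map_mul, eval_X, Sum.elim_inr, eval_rename, Sum.elim_comp_inl, eval_C]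

/-- **Persistence of one non-degenerate polar point in a linear family** (implicit function
theorem).  Let `p_θ = Σ_μ θ_μ q_μ` (`θ ∈ ℂ^ι`) be a linear family of polynomials and let `x₀` be a
polar point of `p_{θ₀}` at the datum `(a, b, c)` at which the bordered-Hessian Jacobian
`[[∂ᵢ∂ⱼp_{θ₀}(x₀), (aᵢ bᵢ)], [(∂ⱼp_{θ₀}(x₀); cⱼ), 0]]` is invertible.  Then there is a branch
`φ : ℂ^ι → ℂ^N`, `φ(θ) → x₀` as `θ → θ₀`, such that for `θ` near `θ₀` the point `φ(θ)` is a polar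
point of `p_θ` at `(a, b, c)` with invertible Jacobian.  Proof: `(x₀, -s, -t)` is a zero of the
square system `((∂ᵢp_θ(x) + s'aᵢ + t'bᵢ)ᵢ, p_θ(x), Σ cⱼxⱼ)` (values `(0, 0, 1)`), jointly
polynomial in `(θ, x, s', t')`, with `z`-Jacobian the displayed matrix; apply
`HasStrictFDerivAt.implicitFunctionOfProdDomain` and keep `∇ ≠ 0`, `det ≠ 0` by continuity.
[folklore] -/
theorem exists_branch (q : ι → MvPolynomial (Fin N) ℂ) (a b c : Fin N → ℂ) (θ₀ : ι → ℂ)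
    (x₀ : Fin N → ℂ) (hx₀ : x₀ ∈ polarSet (∑ μ, C (θ₀ μ) * q μ) a b c)
    (hdet : (Matrix.fromBlocks
        (Matrix.of fun i j : Fin N => eval x₀ (pderiv i (pderiv j (∑ μ, C (θ₀ μ) * q μ))))
        (Matrix.of fun (i : Fin N) (l : Fin 2) => ![a i, b i] l)
        (Matrix.of fun (l : Fin 2) (j : Fin N) =>
          ![eval x₀ (pderiv j (∑ μ, C (θ₀ μ) * q μ)), c j] l)
        (0 : Matrix (Fin 2) (Fin 2) ℂ)).det ≠ 0) :
    ∃ φ : (ι → ℂ) → (Fin N → ℂ), Tendsto φ (𝓝 θ₀) (𝓝 x₀) ∧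
      ∀ᶠ θ in 𝓝 θ₀, φ θ ∈ polarSet (∑ μ, C (θ μ) * q μ) a b c ∧
        (Matrix.fromBlocks
          (Matrix.of fun i j : Fin N => eval (φ θ) (pderiv i (pderiv j (∑ μ, C (θ μ) * q μ))))
          (Matrix.of fun (i : Fin N) (l : Fin 2) => ![a i, b i] l)
          (Matrix.of fun (l : Fin 2) (j : Fin N) =>
            ![eval (φ θ) (pderiv j (∑ μ, C (θ μ) * q μ)), c j] l)
          (0 : Matrix (Fin 2) (Fin 2) ℂ)).det ≠ 0 := by
  -- adapted from Theorems/DetQPDetqpSuperquadraticStubPolarPersistenceND.lean,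
  -- `PolarPersistenceND.exists_branchND`: same implicit-function branch, parameter `θ` instead of `u`
  classical
  -- the joint polynomial `Pj(x, Θ) = Σ_μ Θ_μ q_μ(x)` and its evaluations
  have hb0 : ∀ (x : Fin N → ℂ) (θ : ι → ℂ),
      eval (Sum.elim x θ) (∑ μ, X (Sum.inr μ) * rename Sum.inl (q μ) : MvPolynomial (Fin N ⊕ ι) ℂ)
        = eval x (∑ μ, C (θ μ) * q μ) := fun x θ => eval_joint q x θ
  have hb1 : ∀ (x : Fin N → ℂ) (θ : ι → ℂ) (i : Fin N), eval (Sum.elim x θ)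
      (pderiv (Sum.inl i) (∑ μ, X (Sum.inr μ) * rename Sum.inl (q μ) : MvPolynomial (Fin N ⊕ ι) ℂ))
        = eval x (pderiv i (∑ μ, C (θ μ) * q μ)) := fun x θ i => by
    rw [pderiv_inl_joint, eval_joint, pderiv_family]
  have hb2 : ∀ (x : Fin N → ℂ) (θ : ι → ℂ) (i j : Fin N), eval (Sum.elim x θ)
      (pderiv (Sum.inl i) (pderiv (Sum.inl j)
        (∑ μ, X (Sum.inr μ) * rename Sum.inl (q μ) : MvPolynomial (Fin N ⊕ ι) ℂ)))
        = eval x (pderiv i (pderiv j (∑ μ, C (θ μ) * q μ))) := fun x θ i j => by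
    rw [pderiv_inl_joint, pderiv_inl_joint, eval_joint, pderiv_family, pderiv_family]
  set Pj : MvPolynomial (Fin N ⊕ ι) ℂ := ∑ μ, X (Sum.inr μ) * rename Sum.inl (q μ)
  -- joint continuity of the Jacobian determinant in `(θ, x)`
  have hsw : Continuous fun w : (ι → ℂ) × (Fin N → ℂ) => (Sum.elim w.2 w.1 : Fin N ⊕ ι → ℂ) :=
    continuous_pi fun k => by
      rcases k with j | μ
      · exact (continuous_apply j).comp continuous_snd
      · exact (continuous_apply μ).comp continuous_fst
  have hJ : Continuous fun w : (ι → ℂ) × (Fin N → ℂ) => (Matrix.fromBlocks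
      (Matrix.of fun i j : Fin N => eval w.2 (pderiv i (pderiv j (∑ μ, C (w.1 μ) * q μ))))
      (Matrix.of fun (i : Fin N) (l : Fin 2) => ![a i, b i] l)
      (Matrix.of fun (l : Fin 2) (j : Fin N) =>
        ![eval w.2 (pderiv j (∑ μ, C (w.1 μ) * q μ)), c j] l)
      (0 : Matrix (Fin 2) (Fin 2) ℂ)).det := by
    refine Continuous.matrix_det
      (Continuous.matrix_fromBlocks ?_ continuous_const ?_ continuous_const)
    · exact continuous_matrix fun i j =>
        ((continuous_eval _).comp hsw).congr fun w => hb2 w.2 w.1 i j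
    · refine continuous_matrix ?_
      rw [Fin.forall_fin_two]
      exact ⟨fun j => ((continuous_eval _).comp hsw).congr fun w => hb1 w.2 w.1 j,
        fun j => continuous_const⟩
  -- the base polynomial and the base point
  set p₀ : MvPolynomial (Fin N) ℂ := ∑ μ, C (θ₀ μ) * q μ
  obtain ⟨hg0, ⟨i₀, hi₀⟩, ⟨s₀, t₀, hst⟩, hchart⟩ := hx₀
  have hD0 : eval (Sum.elim x₀ θ₀) Pj = 0 := (hb0 x₀ θ₀).trans hg0
  have hD1 : ∀ j, eval (Sum.elim x₀ θ₀) (pderiv (Sum.inl j) Pj) = eval x₀ (pderiv j p₀) :=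
    fun j => hb1 x₀ θ₀ j
  have hD2 : ∀ i j, eval (Sum.elim x₀ θ₀) (pderiv (Sum.inl j) (pderiv (Sum.inl i) Pj)) =
      eval x₀ (pderiv i (pderiv j p₀)) :=
    fun i j => (hb2 x₀ θ₀ j i).trans (by rw [PolarPersistence.pderiv_pderiv_comm])
  -- base point of the unknowns `z = (x, s', t')` (`s' = -s`, `t' = -t`)
  set z₀ : Fin N ⊕ Fin 2 → ℂ := Sum.elim x₀ ![-s₀, -t₀]
  have hz₀l : ∀ j, z₀ (Sum.inl j) = x₀ j := fun j => rfl
  have hz₀0 : z₀ (Sum.inr 0) = -s₀ := rfl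
  have hz₀1 : z₀ (Sum.inr 1) = -t₀ := rfl
  -- restriction `z ↦ x`
  set R : (Fin N ⊕ Fin 2 → ℂ) →L[ℂ] (Fin N → ℂ) :=
    ContinuousLinearMap.pi fun j => ContinuousLinearMap.proj (Sum.inl j)
  have hRv : ∀ (w : Fin N ⊕ Fin 2 → ℂ) (j : Fin N), R w j = w (Sum.inl j) := fun w j => rfl
  have hRz₀ : R z₀ = x₀ := funext fun j => rfl
  -- the joint variables `(x, θ)` as a continuous linear function of `w = (θ, z)`
  set Λ : (ι → ℂ) × (Fin N ⊕ Fin 2 → ℂ) →L[ℂ] (Fin N ⊕ ι → ℂ) :=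
    ContinuousLinearMap.pi (Sum.elim
      (fun j : Fin N => (ContinuousLinearMap.proj (Sum.inl j) : (Fin N ⊕ Fin 2 → ℂ) →L[ℂ] ℂ).comp
        (ContinuousLinearMap.snd ℂ (ι → ℂ) (Fin N ⊕ Fin 2 → ℂ)))
      (fun μ : ι => (ContinuousLinearMap.proj μ : (ι → ℂ) →L[ℂ] ℂ).comp
        (ContinuousLinearMap.fst ℂ (ι → ℂ) (Fin N ⊕ Fin 2 → ℂ))))
  have hΛ : ∀ w, Λ w = Sum.elim (R w.2) w.1 := fun w => funext fun k => by
    rcases k with j | μ <;> rfl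
  have hΛ₀ : Λ (θ₀, z₀) = Sum.elim x₀ θ₀ := by rw [hΛ, hRz₀]
  -- the Jacobian of the hypothesis
  set M : Matrix (Fin N ⊕ Fin 2) (Fin N ⊕ Fin 2) ℂ := Matrix.fromBlocks
      (Matrix.of fun i j : Fin N => eval x₀ (pderiv i (pderiv j p₀)))
      (Matrix.of fun (i : Fin N) (l : Fin 2) => ![a i, b i] l)
      (Matrix.of fun (l : Fin 2) (j : Fin N) => ![eval x₀ (pderiv j p₀), c j] l)
      (0 : Matrix (Fin 2) (Fin 2) ℂ)
  -- the square system, componentwise, on `parameters × unknowns`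
  set Gc : Fin N ⊕ Fin 2 → (ι → ℂ) × (Fin N ⊕ Fin 2 → ℂ) → ℂ :=
    Sum.elim (fun i w => eval (Λ w) (pderiv (Sum.inl i) Pj) + a i * w.2 (Sum.inr 0) +
        b i * w.2 (Sum.inr 1))
      ![fun w => eval (Λ w) Pj, fun w => ∑ j, c j * w.2 (Sum.inl j)]
  have eGl : ∀ i, Gc (Sum.inl i) = fun w => eval (Λ w) (pderiv (Sum.inl i) Pj) +
      a i * w.2 (Sum.inr 0) + b i * w.2 (Sum.inr 1) := fun i => rfl
  have eG0 : Gc (Sum.inr 0) = fun w => eval (Λ w) Pj := rfl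
  have eG1 : Gc (Sum.inr 1) = fun w => ∑ j, c j * w.2 (Sum.inl j) := rfl
  -- strict derivatives of the building blocks at `(θ₀, z₀)`: coordinates of `z` and `w ↦ Q(Λ w)`
  set pz : Fin N ⊕ Fin 2 → ((ι → ℂ) × (Fin N ⊕ Fin 2 → ℂ) →L[ℂ] ℂ) :=
    fun k => (ContinuousLinearMap.proj k).comp (ContinuousLinearMap.snd ℂ _ _)
  have hpz : ∀ k, HasStrictFDerivAt
      (fun w : (ι → ℂ) × (Fin N ⊕ Fin 2 → ℂ) => w.2 k) (pz k) (θ₀, z₀) :=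
    fun k => (pz k).hasStrictFDerivAt
  have hpzv : ∀ k w, pz k w = w.2 k := fun k w => rfl
  have hev : ∀ Q : MvPolynomial (Fin N ⊕ ι) ℂ, HasStrictFDerivAt
      (fun w : (ι → ℂ) × (Fin N ⊕ Fin 2 → ℂ) => eval (Λ w) Q)
      ((∑ k, eval (Λ (θ₀, z₀)) (pderiv k Q) •
        (ContinuousLinearMap.proj k : (Fin N ⊕ ι → ℂ) →L[ℂ] ℂ)).comp Λ) (θ₀, z₀) :=
    fun Q => (PolarPersistence.hasStrictFDerivAt_eval Q (Λ (θ₀, z₀))).comp (θ₀, z₀)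
      Λ.hasStrictFDerivAt
  -- each component is strictly differentiable, with `z`-partial the corresponding row of `M`
  have hcomp : ∀ k, ∃ E : (ι → ℂ) × (Fin N ⊕ Fin 2 → ℂ) →L[ℂ] ℂ,
      HasStrictFDerivAt (Gc k) E (θ₀, z₀) ∧ ∀ v, E (0, v) = (M.mulVec v) k := by
    rintro (i | l)
    · rw [eGl i]
      refine ⟨_, ((hev (pderiv (Sum.inl i) Pj)).fun_add ((hpz _).const_mul (a i))).fun_add
        ((hpz _).const_mul (b i)), fun v => ?_⟩
      simp [hΛ, hRv, hRz₀, hpzv, hD2 i, M, Matrix.mulVec, dotProduct, Fintype.sum_sum_type,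
        Fin.sum_univ_two]
      ring
    · revert l
      rw [Fin.forall_fin_two]
      refine ⟨?_, ?_⟩
      · rw [eG0]
        refine ⟨_, hev Pj, fun v => ?_⟩
        simp [hΛ, hRv, hRz₀, hD1, M, Matrix.mulVec, dotProduct, Fintype.sum_sum_type]
      · rw [eG1]
        refine ⟨_, HasStrictFDerivAt.fun_sum fun j _ => (hpz (Sum.inl j)).const_mul (c j),
          fun v => ?_⟩
        simp [hpzv, M, Matrix.mulVec, dotProduct, Fintype.sum_sum_type]
  choose E hE hEv using hcomp
  have hG : HasStrictFDerivAt (fun w k => Gc k w) (ContinuousLinearMap.pi E) (θ₀, z₀) :=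
    hasStrictFDerivAt_pi.2 hE
  -- the partial derivative in the unknowns is `M`, hence invertible
  set T := (ContinuousLinearMap.pi E).comp
    (ContinuousLinearMap.inr ℂ (ι → ℂ) (Fin N ⊕ Fin 2 → ℂ))
  have hTM : (T : (Fin N ⊕ Fin 2 → ℂ) →ₗ[ℂ] (Fin N ⊕ Fin 2 → ℂ)) = Matrix.toLin' M := by
    refine LinearMap.ext fun v => funext fun k => ?_
    rw [Matrix.toLin'_apply]
    exact hEv k v
  have hdetT : T.det ≠ 0 := by
    change LinearMap.det (T : (Fin N ⊕ Fin 2 → ℂ) →ₗ[ℂ] (Fin N ⊕ Fin 2 → ℂ)) ≠ 0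
    rw [hTM, LinearMap.det_toLin']
    exact hdet
  have hinv : T.IsInvertible :=
    ⟨T.toContinuousLinearEquivOfDetNeZero hdetT,
      ContinuousLinearMap.coe_toContinuousLinearEquivOfDetNeZero T hdetT⟩
  -- the implicit function `ψ : θ ↦ z(θ)` and the branch `φ = R ∘ ψ`
  set ψ := hG.implicitFunctionOfProdDomain hinv
  have hψt : Tendsto ψ (𝓝 θ₀) (𝓝 z₀) := hG.tendsto_implicitFunctionOfProdDomain hinv
  have hψe : ∀ᶠ θ in 𝓝 θ₀, (fun k => Gc k (θ, ψ θ)) = fun k => Gc k (θ₀, z₀) :=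
    hG.eventually_apply_implicitFunctionOfProdDomain hinv
  have hRψ : Tendsto (fun θ => R (ψ θ)) (𝓝 θ₀) (𝓝 x₀) := by
    rw [← hRz₀]
    exact (R.continuous.tendsto z₀).comp hψt
  have hΛψ : Tendsto (fun θ => Λ (θ, ψ θ)) (𝓝 θ₀) (𝓝 (Sum.elim x₀ θ₀)) := by
    rw [← hΛ₀]
    exact (Λ.continuous.tendsto _).comp (tendsto_id.prodMk_nhds hψt)
  refine ⟨fun θ => R (ψ θ), hRψ, ?_⟩
  -- `∇ p_θ ≠ 0` persists
  have hgrad : ∀ᶠ θ in 𝓝 θ₀, eval (R (ψ θ)) (pderiv i₀ (∑ μ, C (θ μ) * q μ)) ≠ 0 := by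
    have h0 : eval (Sum.elim x₀ θ₀) (pderiv (Sum.inl i₀) Pj) ≠ 0 := by
      rw [hD1]
      exact hi₀
    have h1 : Tendsto (fun θ => eval (Λ (θ, ψ θ)) (pderiv (Sum.inl i₀) Pj)) (𝓝 θ₀)
        (𝓝 (eval (Sum.elim x₀ θ₀) (pderiv (Sum.inl i₀) Pj))) :=
      ((continuous_eval _).tendsto _).comp hΛψ
    refine (h1.eventually_ne h0).mono fun θ h => ?_
    rwa [hΛ, hb1] at h
  -- non-degeneracy persists: `det J` is continuous in `(θ, x)` and `≠ 0` at `(θ₀, x₀)`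
  have hndeg : ∀ᶠ θ in 𝓝 θ₀, (Matrix.fromBlocks
      (Matrix.of fun i j : Fin N => eval (R (ψ θ)) (pderiv i (pderiv j (∑ μ, C (θ μ) * q μ))))
      (Matrix.of fun (i : Fin N) (l : Fin 2) => ![a i, b i] l)
      (Matrix.of fun (l : Fin 2) (j : Fin N) =>
        ![eval (R (ψ θ)) (pderiv j (∑ μ, C (θ μ) * q μ)), c j] l)
      (0 : Matrix (Fin 2) (Fin 2) ℂ)).det ≠ 0 :=
    ((hJ.tendsto (θ₀, x₀)).comp (tendsto_id.prodMk_nhds hRψ)).eventually_ne hdet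
  filter_upwards [hψe, hgrad, hndeg] with θ hu hgu hdu
  refine ⟨?_, hdu⟩
  have h1 : ∀ i, Gc (Sum.inl i) (θ, ψ θ) = Gc (Sum.inl i) (θ₀, z₀) :=
    fun i => congr_fun hu (Sum.inl i)
  have h2 : Gc (Sum.inr 0) (θ, ψ θ) = Gc (Sum.inr 0) (θ₀, z₀) := congr_fun hu (Sum.inr 0)
  have h3 : Gc (Sum.inr 1) (θ, ψ θ) = Gc (Sum.inr 1) (θ₀, z₀) := congr_fun hu (Sum.inr 1)
  rw [eG0] at h2
  rw [eG1] at h3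
  simp only [hΛ₀, hD0, hz₀l] at h2 h3
  rw [hΛ, hb0] at h2
  refine mem_polarSet.2 ⟨h2, ⟨i₀, hgu⟩, ⟨-ψ θ (Sum.inr 0), -ψ θ (Sum.inr 1), fun i => ?_⟩, ?_⟩
  · have h1i := h1 i
    simp only [eGl, hΛ₀, hD1, hz₀0, hz₀1, hst i] at h1i
    rw [hΛ, hb1] at h1i
    linear_combination h1i
  · simp only [hRv]
    exact h3.trans hchart

end PolarPersistenceCoeff

/-- **Stub T2 (persistence of non-degenerate polar points under coefficient perturbation).**  If at
the datum `(a, b, c)` the polar set of `g` contains a finite set `F` of non-degenerate polar points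
(bordered-Hessian Jacobian invertible) and `G_j → g` coefficientwise with bounded total degree,
then for all large `j` the polar set of `G_j` at the SAME datum contains at least `|F|`
non-degenerate polar points.  (Implicit function theorem for the square polar system, with the
coefficients of the polynomial on a fixed finite set of monomials as parameters — the proof of the
tree's `stub_polarPersistenceND` with `u` replaced by the coefficient vector:
`PolarPersistenceCoeff.exists_branch` applied to the linear family of the monomials of degree
`≤ d`, pulled back along the convergent sequence of coefficient vectors.) [folklore] -/
theorem stub_polarPersistenceCoeff {N d : ℕ} (g : MvPolynomial (Fin N) ℂ) (a b c : Fin N → ℂ)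
    (F : Finset (Fin N → ℂ))
    (hF : ∀ x ∈ F, x ∈ polarSet g a b c ∧
      (Matrix.fromBlocks
        (Matrix.of fun i j : Fin N => eval x (pderiv i (pderiv j g)))
        (Matrix.of fun (i : Fin N) (l : Fin 2) => ![a i, b i] l)
        (Matrix.of fun (l : Fin 2) (j : Fin N) => ![eval x (pderiv j g), c j] l)
        (0 : Matrix (Fin 2) (Fin 2) ℂ)).det ≠ 0)
    (G : ℕ → MvPolynomial (Fin N) ℂ) (hdeg : ∀ j, (G j).totalDegree ≤ d)
    (hconv : ∀ ν : Fin N →₀ ℕ, Tendsto (fun j => (G j).coeff ν) atTop (𝓝 (g.coeff ν))) :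
    ∀ᶠ j in atTop, ∃ F' : Finset (Fin N → ℂ), F.card ≤ F'.card ∧
      ∀ x ∈ F', x ∈ polarSet (G j) a b c ∧
        (Matrix.fromBlocks
          (Matrix.of fun i j' : Fin N => eval x (pderiv i (pderiv j' (G j))))
          (Matrix.of fun (i : Fin N) (l : Fin 2) => ![a i, b i] l)
          (Matrix.of fun (l : Fin 2) (j' : Fin N) => ![eval x (pderiv j' (G j)), c j'] l)
          (0 : Matrix (Fin 2) (Fin 2) ℂ)).det ≠ 0 := by
  classical
  -- the finite set `S` of exponents of degree `≤ d`; all `G j`, hence `g`, are supported on `S`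
  obtain ⟨S, hS⟩ : ∃ S : Finset (Fin N →₀ ℕ), ∀ ν : Fin N →₀ ℕ, ν ∉ S → d < ν.degree :=
    ⟨(Finsupp.finite_of_degree_le d).toFinset, fun _ hν =>
      not_le.mp fun h => hν ((Finsupp.finite_of_degree_le d).mem_toFinset.mpr h)⟩
  have hG0 : ∀ j, ∀ ν ∉ S, (G j).coeff ν = 0 := fun j ν hν => by
    have hlt := (hdeg j).trans_lt (hS ν hν)
    rw [Finsupp.degree_apply] at hlt
    exact coeff_eq_zero_of_totalDegree_lt hlt
  have hg0 : ∀ ν ∉ S, g.coeff ν = 0 := fun ν hν => by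
    have h0 : Tendsto (fun j => (G j).coeff ν) atTop (𝓝 0) := by
      have : (fun j => (G j).coeff ν) = fun _ => (0 : ℂ) := funext fun j => hG0 j ν hν
      rw [this]
      exact tendsto_const_nhds
    exact tendsto_nhds_unique (hconv ν) h0
  -- a polynomial supported on `S` is the member `θ = (its coefficients)` of the family of monomials
  have hrec : ∀ p : MvPolynomial (Fin N) ℂ, (∀ ν ∉ S, p.coeff ν = 0) →
      ∑ μ : ↥S, C (p.coeff ↑μ) * monomial (↑μ : Fin N →₀ ℕ) (1 : ℂ) = p := by
    intro p hp
    calc ∑ μ : ↥S, C (p.coeff ↑μ) * monomial (↑μ : Fin N →₀ ℕ) (1 : ℂ)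
          = ∑ ν ∈ S, C (p.coeff ν) * monomial ν (1 : ℂ) :=
            Finset.sum_coe_sort S (fun ν => C (p.coeff ν) * monomial ν (1 : ℂ))
      _ = ∑ ν ∈ S, monomial ν (p.coeff ν) := by simp only [C_mul_monomial, mul_one]
      _ = ∑ ν ∈ p.support, monomial ν (p.coeff ν) := by
            refine (Finset.sum_subset (fun ν hν => ?_) fun ν _ hν => ?_).symm
            · by_contra h
              exact (mem_support_iff.mp hν) (hp ν h)
            · rw [notMem_support_iff.mp hν, map_zero]
      _ = p := (as_sum p).symm
  -- the family of monomials of `S`, and the coefficient vectors of `g` and of the `G j`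
  set q : ↥S → MvPolynomial (Fin N) ℂ := fun μ => monomial (↑μ : Fin N →₀ ℕ) (1 : ℂ)
  set θ₀ : ↥S → ℂ := fun μ => g.coeff ↑μ
  set Θ : ℕ → ↥S → ℂ := fun j μ => (G j).coeff ↑μ
  have hΘ : Tendsto Θ atTop (𝓝 θ₀) := tendsto_pi_nhds.2 fun μ => hconv ↑μ
  have hpg : ∑ μ, C (θ₀ μ) * q μ = g := hrec g hg0
  have hpG : ∀ j, ∑ μ, C (Θ j μ) * q μ = G j := fun j => hrec (G j) (hG0 j)
  -- one continuous branch of NON-DEGENERATE polar points of `p_θ` through each point of `F`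
  have key : ∀ x ∈ F, ∃ φ : (↥S → ℂ) → (Fin N → ℂ), Tendsto φ (𝓝 θ₀) (𝓝 x) ∧
      ∀ᶠ θ in 𝓝 θ₀, φ θ ∈ polarSet (∑ μ, C (θ μ) * q μ) a b c ∧
        (Matrix.fromBlocks
          (Matrix.of fun i j' : Fin N =>
            eval (φ θ) (pderiv i (pderiv j' (∑ μ, C (θ μ) * q μ))))
          (Matrix.of fun (i : Fin N) (l : Fin 2) => ![a i, b i] l)
          (Matrix.of fun (l : Fin 2) (j' : Fin N) =>
            ![eval (φ θ) (pderiv j' (∑ μ, C (θ μ) * q μ)), c j'] l)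
          (0 : Matrix (Fin 2) (Fin 2) ℂ)).det ≠ 0 := by
    intro x hx
    obtain ⟨hmem, hdet⟩ := hF x hx
    refine PolarPersistenceCoeff.exists_branch q a b c θ₀ x ?_ ?_
    · rw [hpg]
      exact hmem
    · rw [hpg]
      exact hdet
  choose! φ hφt hφm using key
  -- near `θ₀` all branches are non-degenerate polar points and pairwise distinct
  have hev₁ := (Filter.eventually_all_finset F).2 hφm
  have hev₂ : ∀ᶠ θ in 𝓝 θ₀, ∀ x ∈ F, ∀ x' ∈ F, x ≠ x' → φ x θ ≠ φ x' θ := by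
    refine (Filter.eventually_all_finset F).2 fun x hx =>
      (Filter.eventually_all_finset F).2 fun x' hx' => ?_
    by_cases hxx' : x = x'
    · exact Filter.Eventually.of_forall fun θ h => (h hxx').elim
    · exact (((hφt x hx).prodMk_nhds (hφt x' hx')).eventually
        ((isOpen_ne_fun continuous_fst continuous_snd).mem_nhds hxx')).mono fun θ h _ => h
  -- pull back along `j ↦ Θ j → θ₀`
  filter_upwards [hΘ.eventually (hev₁.and hev₂)] with j hj
  obtain ⟨h₁, h₂⟩ := hj
  refine ⟨F.image fun x => φ x (Θ j), ?_, fun y hy => ?_⟩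
  · rw [Finset.card_image_of_injOn fun x hx x' hx' h =>
      by_contra fun hne => h₂ x hx x' hx' hne h]
  · obtain ⟨x, hx, rfl⟩ := Finset.mem_image.1 hy
    have hxj := h₁ x hx
    rwa [hpG j] at hxj

end Summit.ValiantsHypothesis.ValiantsHypothesis.Theorems.RefutationDegree

end
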